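import Mathlib
import Summits.CriticalPhenomena.CardyFormulaZ2.Theorems.CardySelfRefinementDefs
import Summits.CriticalPhenomena.CardyFormulaZ2.Theorems.CardySelfRefinementTrivialSectorRateStubSixArmDecayReduction
import Summits.CriticalPhenomena.CardyFormulaZ2.Theorems.CardySelfRefinementTrivialSectorRateStubSixArmDecayDualArm
import Literature.Probability.Percolation.ZdFourArmFromFiveArm
import HarnessLib

/-!
# Stub `stub_sixArmDecay` of line `far-field-is-a-quarter-turn` (crux `TrivialSectorRate`,
stmt-CriticalPhenomena-10266): THE PRICE OF THE SIXTH ARM, REDUCED TO A SUB-MULTIPLICATIVITY INPUT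

The sixth-arm price (S6) of `sixArmDecayAlong_of_fiveArm` (file `…StubSixArmDecayReduction.lean`)
reads `M_k(γ s)(six arms across c + A_{m,n}) ≤ C₆ (m/n)^δ · M_k(γ s)(ω - c ∈ zdFiveArmClusters m n)`.
In print (Bernoulli percolation) it is Reimer's inequality `𝒜₆ ⊆ 𝒜₅ □ 𝒜₁`,
`P(𝒜₆) ≤ P(𝒜₅) · P(closed dual arm)`, followed by the one-arm decay `P(dual arm) ≤ C (m/n)^δ`.
The second factor is now in the tree for the dependent model `M_k` along every admissible path
(`dualArm_decay_along`, file `…StubSixArmDecayDualArm.lean`).  This file proves the bookkeeping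
that turns the FIRST factor — a sub-multiplicativity statement for the specific pair
(five arms, sixth dual arm), the only remaining input of (S6) — into (S6) and into the stub:

* **`sixArm_le_pow_mul_fiveArm_of_subMult`** (registered helper) — IF along the path, for
  `m ≥ m₁` and `A² m ≤ n`,
  `M_k(γ s)(sixArmThreeClustersAt c m n) ≤ C · M_k(γ s)(ω - c ∈ zdFiveArmClusters m n) ·
  M_k(γ s)(closed dual arm from c + B(m'-1) to outside c + B(n'))` for SOME comparable sub-annulus
  `m ≤ m' ≤ A m`, `n ≤ A n'` (Reimer's inequality would give `m' = m`, `n' = n`, `C = 1`), THEN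
  (S6) holds with `δ = a`, the dual one-arm exponent of `dualArm_decay_along` (large ratios by the
  hypothesis and `(m'/n')^a ≤ A^{2a} (m/n)^a`; bounded ratios `n < A² m` are free because six arms
  contain five, `real_sixArmThreeClustersAt_le_zdFiveArm`);
* **`sixArmDecayAlong_of_fiveArm_subMult`** (registered helper) — the same sub-multiplicativity
  with the five-arm factor also taken on a comparable sub-annulus `A_{m',n'}` (and the dual arm on
  its own comparable sub-annulus `A_{m'',n''}`), together with the five-arm upper bound (S5), gives
  `SixArmDecayAlong k γ` directly (exponent `2 + a`; `sixArmDecayAlong_of_large_scales` removes the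
  restrictions on the radii).

What is NOT claimed.  The deterministic route to `hR` — a planar inclusion "six arms across
`c + A_{m,n}` ⊆ (five arms across `c + A_{m,n'}`) □ (closed dual arm across a sub-annulus
`c + A_{m'',n''}`) with COIN-disjoint edge witnesses", to be fed into
`M_real_le_mul_of_coinDisjoint_witnesses` (file `…StubSixArmDecayReimer.lean`) — FAILS for `k = 3`
as soon as the rows `[m, n']` and `[m'', n'']` have a multiple of `3` in common (and radially
disjoint ranges cannot reach the exponent `2 + ε`).  Take the lattice configuration whose open edges are the vertical edges of the two
columns `x = 1`, `x = 2` between the rows `m` and `n` and all annulus edges off the strip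
`x ∈ {1, 2}`, everything else closed (`m ≥ 3`; three crossing clusters of `A_{m,n}`, six arms).
A cylinder witness of the five-arm event must contain ALL closed rungs, rows `m … n'`, of two of the
three closed corridors `[0,1], [1,2], [2,3] × {y}` (opening one rung in each of two corridors merges
the three clusters), a cylinder witness of the dual arm must contain the rungs, rows `m'' … n''`, of
the remaining corridor (the corridors are the only dual passages through the ring), and on an axial
row `y ∈ 3ℤ` the three rungs are the three sub-edges of ONE bundle, reading a common shared coin and
selector: the two coin windows meet.  (The coin-level inclusion behind
`M_real_le_mul_of_preimage_subset_disjointOccurrence` fails likewise, on the coin configurations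
with that bundle's selector on.)  So for `M_k` the sub-multiplicativity `hR` is a genuinely
probabilistic statement (expected by universality; a proof needs arm-separation technology for
`M_k`, as does (S5)); it is isolated here as the hypothesis.

References: H. Kesten, Comm. Math. Phys. 109 (1987) (arm separation); D. Reimer, Combin. Probab.
Comput. 9 (2000); P. Nolin, Electron. J. Probab. 13 (2008), §4–5; G. Grimmett, *Percolation*
(1999), §11.7.

Target file:
`Summits/CriticalPhenomena/CardyFormulaZ2/Theorems/CardySelfRefinementTrivialSectorRateStubSixArmDecaySixthArm.lean`.
-/

noncomputable section

namespace Summit.CriticalPhenomena.CardyFormulaZ2.Theorems.CardySelfRefinement.FarField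

open Set MeasureTheory
open Literature.Probability.LatticeModels Literature.Probability.Percolation
open Literature.Probability.Percolation.QuadCrossing
open Summit.CriticalPhenomena.CardyFormulaZ2.Theses.CardySelfRefinement

/-! ### Arithmetic of comparable sub-annuli -/

/-- Comparable sub-annuli have comparable aspect ratios: `m' ≤ A m` and `n ≤ A n'` give
`m'/n' ≤ A² (m/n)` (for `n, n' > 0`). -/
theorem subAnnulus_ratio_le {A m n m' n' : ℕ} (hn : 0 < n) (hn' : 0 < n') (hm' : m' ≤ A * m)
    (hnA : n ≤ A * n') : (m' : ℝ) / n' ≤ (A : ℝ) * A * ((m : ℝ) / n) := by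
  have hn0 : (0 : ℝ) < n := by exact_mod_cast hn
  have hn'0 : (0 : ℝ) < n' := by exact_mod_cast hn'
  rw [show (A : ℝ) * A * ((m : ℝ) / n) = (A : ℝ) * A * m / n by ring, div_le_div_iff₀ hn'0 hn0]
  have h : m' * n ≤ A * A * m * n' := by
    calc m' * n ≤ (A * m) * (A * n') := Nat.mul_le_mul hm' hnA
      _ = A * A * m * n' := by ring
  exact_mod_cast h

/-- The power form: `(m'/n')^a ≤ (A²)^a (m/n)^a` for comparable sub-annuli and `a ≥ 0`. -/
theorem subAnnulus_ratio_rpow_le {A m n m' n' : ℕ} (hn : 0 < n) (hn' : 0 < n') (hm' : m' ≤ A * m)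
    (hnA : n ≤ A * n') {a : ℝ} (ha : 0 ≤ a) :
    ((m' : ℝ) / n') ^ a ≤ ((A : ℝ) * A) ^ a * ((m : ℝ) / n) ^ a := by
  rw [← Real.mul_rpow (by positivity) (by positivity)]
  exact Real.rpow_le_rpow (by positivity) (subAnnulus_ratio_le hn hn' hm' hnA) ha

/-- Bounded ratios are free: if `n < A² m` then `1 ≤ (A²)^a (m/n)^a` (`a ≥ 0`, `n > 0`). -/
theorem one_le_rpow_mul_of_ratio_lt {A m n : ℕ} (hn : 0 < n) (hAn : n < A * A * m) {a : ℝ}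
    (ha : 0 ≤ a) : 1 ≤ ((A : ℝ) * A) ^ a * ((m : ℝ) / n) ^ a := by
  have hn0 : (0 : ℝ) < n := by exact_mod_cast hn
  rw [← Real.mul_rpow (by positivity) (by positivity)]
  refine Real.one_le_rpow ?_ ha
  rw [show (A : ℝ) * A * ((m : ℝ) / n) = (A : ℝ) * A * m / n by ring, le_div_iff₀ hn0, one_mul]
  exact_mod_cast hAn.le

/-! ### (S6) from sub-multiplicativity and the dual one-arm decay -/

/-- **The price of the sixth arm from sub-multiplicativity** (registered helper of the stub
`stub_sixArmDecay`; produces the input (S6) of `sixArmDecayAlong_of_fiveArm`).  Suppose that along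
the admissible path `γ` (`PathOK k γ`, `k = 2, 3`) the six-arm probability is sub-multiplicative
over the pair (five arms, sixth closed dual arm): for `m ≥ m₁` and `A² m ≤ n` there is a comparable
sub-annulus `m ≤ m' ≤ A m`, `n ≤ A n'` with
`M_k(γ s)(sixArmThreeClustersAt c m n) ≤ C · M_k(γ s)(ω - c ∈ zdFiveArmClusters m n) ·
M_k(γ s)(closed dual arm from a face indexed in c + B(m'-1) to a face indexed outside c + B(n'))`
(hypothesis `hR`; for Bernoulli percolation this is Reimer's inequality with `m' = m`, `n' = n`,
`C = 1`).  Then (S6): `M_k(γ s)(six arms) ≤ C₆ (m/n)^δ · M_k(γ s)(five arms)` for all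
`m₀ ≤ m ≤ n`, uniformly in `s` and `c`, with `δ = a` the dual one-arm exponent of
`dualArm_decay_along` — large ratios by `hR` and `(m'/n')^a ≤ A^{2a} (m/n)^a`, bounded ratios
`n < A² m` because six arms contain five (`real_sixArmThreeClustersAt_le_zdFiveArm`). -/
theorem sixArm_le_pow_mul_fiveArm_of_subMult {k : ℕ} (hk : k = 2 ∨ k = 3)
    {γ : unitInterval → ℝ × ℝ} (hγ : PathOK k γ)
    (hR : ∃ (C : ℝ) (m₁ A : ℕ), 1 ≤ A ∧ ∀ (s : unitInterval) (c : Site 2) (m n : ℕ), m₁ ≤ m →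
      A * A * m ≤ n → ∃ m' n' : ℕ, m ≤ m' ∧ m' ≤ A * m ∧ n ≤ A * n' ∧
        (M k (γ s).1 (γ s).2).real (sixArmThreeClustersAt c m n) ≤
          C * (M k (γ s).1 (γ s).2).real
              (BondConfig.relabel (sym2Equiv (Site.shift (-c))) ⁻¹' zdFiveArmClusters m n) *
            (M k (γ s).1 (γ s).2).real {ω | ∃ (u w : Site 2) (q : (zdGraph 2).Walk u w),
              u - c ∈ box 2 (m' - 1) ∧ w - c ∉ box 2 n' ∧ ∀ e ∈ q.edges, e ∈ dualConfig ω}) :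
    ∃ δ C₆ : ℝ, 0 < δ ∧ ∃ m₀ : ℕ, ∀ (s : unitInterval) (c : Site 2) (m n : ℕ), m₀ ≤ m → m ≤ n →
      (M k (γ s).1 (γ s).2).real (sixArmThreeClustersAt c m n) ≤
        C₆ * ((m : ℝ) / n) ^ δ *
          (M k (γ s).1 (γ s).2).real
            (BondConfig.relabel (sym2Equiv (Site.shift (-c))) ⁻¹' zdFiveArmClusters m n) := by
  obtain ⟨c', a, hc', ha, m₀, hdual⟩ := dualArm_decay_along hk hγ
  obtain ⟨C, m₁, A, hA, hR⟩ := hR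
  -- nonnegative constants
  set D : ℝ := max C 0 with hD
  have hD0 : 0 ≤ D := le_max_right _ _
  set B : ℝ := ((A : ℝ) * A) ^ a with hB
  have hB0 : 0 ≤ B := Real.rpow_nonneg (by positivity) _
  refine ⟨a, D * c' * B + B, ha, max (max m₀ m₁) 1, fun s c m n hm hmn => ?_⟩
  have hm0 : m₀ ≤ m := ((le_max_left _ _).trans (le_max_left _ _)).trans hm
  have hm1 : m₁ ≤ m := ((le_max_right _ _).trans (le_max_left _ _)).trans hm
  have hmpos : 1 ≤ m := (le_max_right _ _).trans hm
  have hnpos : 0 < n := lt_of_lt_of_le (by omega) hmn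
  set q : ℝ := (m : ℝ) / n with hq
  have hq0 : 0 ≤ q := by positivity
  have hqa : 0 ≤ q ^ a := Real.rpow_nonneg hq0 _
  set P5 : ℝ := (M k (γ s).1 (γ s).2).real
    (BondConfig.relabel (sym2Equiv (Site.shift (-c))) ⁻¹' zdFiveArmClusters m n) with hP5
  have hP50 : 0 ≤ P5 := measureReal_nonneg
  have hsix5 : (M k (γ s).1 (γ s).2).real (sixArmThreeClustersAt c m n) ≤ P5 :=
    real_sixArmThreeClustersAt_le_zdFiveArm k (γ s).1 (γ s).2 c m n
  by_cases hAn : A * A * m ≤ n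
  · -- large ratio: sub-multiplicativity and the dual one-arm decay on the sub-annulus
    obtain ⟨m', n', hmm', hm'A, hnA, hle⟩ := hR s c m n hm1 hAn
    have hm'n' : m' ≤ n' := by
      have h1 : A * m' ≤ A * n' := by
        calc A * m' ≤ A * (A * m) := Nat.mul_le_mul_left A hm'A
          _ = A * A * m := by ring
          _ ≤ n := hAn
          _ ≤ A * n' := hnA
      exact Nat.le_of_mul_le_mul_left h1 (by omega)
    have hn'pos : 0 < n' := by
      have : 0 < A * n' := lt_of_lt_of_le hnpos hnA
      exact Nat.pos_of_mul_pos_left this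
    set Pd : ℝ := (M k (γ s).1 (γ s).2).real {ω | ∃ (u w : Site 2) (q : (zdGraph 2).Walk u w),
      u - c ∈ box 2 (m' - 1) ∧ w - c ∉ box 2 n' ∧ ∀ e ∈ q.edges, e ∈ dualConfig ω} with hPd
    have hPd0 : 0 ≤ Pd := measureReal_nonneg
    have hd : Pd ≤ c' * (B * q ^ a) :=
      (hdual s c m' n' (hm0.trans hmm') hm'n').trans
        (mul_le_mul_of_nonneg_left (subAnnulus_ratio_rpow_le hnpos hn'pos hm'A hnA ha.le) hc'.le)
    calc (M k (γ s).1 (γ s).2).real (sixArmThreeClustersAt c m n) ≤ C * P5 * Pd := hle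
      _ ≤ D * P5 * Pd :=
          mul_le_mul_of_nonneg_right (mul_le_mul_of_nonneg_right (le_max_left _ _) hP50) hPd0
      _ ≤ D * P5 * (c' * (B * q ^ a)) := mul_le_mul_of_nonneg_left hd (mul_nonneg hD0 hP50)
      _ = D * c' * B * q ^ a * P5 := by ring
      _ ≤ (D * c' * B + B) * q ^ a * P5 :=
          mul_le_mul_of_nonneg_right (mul_le_mul_of_nonneg_right (by linarith) hqa) hP50
  · -- bounded ratio: six arms contain five, and `(A²)^a (m/n)^a ≥ 1`
    have hone : 1 ≤ B * q ^ a := one_le_rpow_mul_of_ratio_lt hnpos (not_le.1 hAn) ha.le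
    have hDcB : 0 ≤ D * c' * B := mul_nonneg (mul_nonneg hD0 hc'.le) hB0
    calc (M k (γ s).1 (γ s).2).real (sixArmThreeClustersAt c m n) ≤ P5 := hsix5
      _ = 1 * P5 := (one_mul _).symm
      _ ≤ B * q ^ a * P5 := mul_le_mul_of_nonneg_right hone hP50
      _ ≤ (D * c' * B + B) * q ^ a * P5 := by
          refine mul_le_mul_of_nonneg_right ?_ hP50
          have : B * q ^ a ≤ (D * c' * B + B) * q ^ a :=
            mul_le_mul_of_nonneg_right (by linarith) hqa
          exact this

/-! ### The stub from (S5), sub-multiplicativity and the dual one-arm decay -/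

/-- **`SixArmDecayAlong` from the five-arm upper bound and sub-multiplicativity of the sixth arm**
(registered helper of the stub `stub_sixArmDecay`).  Along an admissible path (`PathOK k γ`,
`k = 2, 3`) assume
(S5) `M_k(γ s)(ω - c ∈ zdFiveArmClusters m n) ≤ C₅ (m/n)²` for `m₀ ≤ m ≤ n`, uniformly in `s`, `c`,
and the sub-multiplicativity `hR` of the sixth arm with BOTH factors on comparable sub-annuli:
for `m ≥ m₁`, `A² m ≤ n` there are `m ≤ m', m'' ≤ A m`, `n ≤ A n', A n''` with
`M_k(γ s)(sixArmThreeClustersAt c m n) ≤ C · M_k(γ s)(ω - c ∈ zdFiveArmClusters m' n') ·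
M_k(γ s)(closed dual arm from c + B(m''-1) to outside c + B(n''))`.  Then `SixArmDecayAlong k γ`
with exponent `2 + a`, `a` the dual one-arm exponent of `dualArm_decay_along`: on large scales and
ratios the three bounds multiply to `C' (A² m/n)^{2+a}`, and `sixArmDecayAlong_of_large_scales`
removes the restrictions on the radii. -/
theorem sixArmDecayAlong_of_fiveArm_subMult {k : ℕ} (hk : k = 2 ∨ k = 3)
    {γ : unitInterval → ℝ × ℝ} (hγ : PathOK k γ)
    (h₅ : ∃ C₅ : ℝ, ∃ m₀ : ℕ, ∀ (s : unitInterval) (c : Site 2) (m n : ℕ), m₀ ≤ m → m ≤ n →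
      (M k (γ s).1 (γ s).2).real
          (BondConfig.relabel (sym2Equiv (Site.shift (-c))) ⁻¹' zdFiveArmClusters m n) ≤
        C₅ * ((m : ℝ) / n) ^ 2)
    (hR : ∃ (C : ℝ) (m₁ A : ℕ), 1 ≤ A ∧ ∀ (s : unitInterval) (c : Site 2) (m n : ℕ), m₁ ≤ m →
      A * A * m ≤ n → ∃ m' n' m'' n'' : ℕ, m ≤ m' ∧ m' ≤ A * m ∧ n ≤ A * n' ∧
        m ≤ m'' ∧ m'' ≤ A * m ∧ n ≤ A * n'' ∧
        (M k (γ s).1 (γ s).2).real (sixArmThreeClustersAt c m n) ≤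
          C * (M k (γ s).1 (γ s).2).real
              (BondConfig.relabel (sym2Equiv (Site.shift (-c))) ⁻¹' zdFiveArmClusters m' n') *
            (M k (γ s).1 (γ s).2).real {ω | ∃ (u w : Site 2) (q : (zdGraph 2).Walk u w),
              u - c ∈ box 2 (m'' - 1) ∧ w - c ∉ box 2 n'' ∧ ∀ e ∈ q.edges, e ∈ dualConfig ω}) :
    SixArmDecayAlong k γ := by
  obtain ⟨c', a, hc', ha, m₀, hdual⟩ := dualArm_decay_along hk hγ
  obtain ⟨C₅, m₅, h₅⟩ := h₅
  obtain ⟨C, m₁, A, hA, hR⟩ := hR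
  -- nonnegative constants
  set D : ℝ := max C 0 with hD
  have hD0 : 0 ≤ D := le_max_right _ _
  set D₅ : ℝ := max C₅ 0 with hD₅
  have hD₅0 : 0 ≤ D₅ := le_max_right _ _
  set B : ℝ := ((A : ℝ) * A) ^ a with hB
  have hB0 : 0 ≤ B := Real.rpow_nonneg (by positivity) _
  set B₂ : ℝ := ((A : ℝ) * A) ^ (2 : ℕ) with hB₂
  have hAA1 : 1 ≤ A * A := le_trans hA (Nat.le_mul_of_pos_right A (by omega))
  refine sixArmDecayAlong_of_large_scales k γ ⟨a, D * (D₅ * B₂) * (c' * B), ha,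
    max (max m₀ m₁) (max m₅ 1), A * A, hAA1, fun s c m n hm hAn => ?_⟩
  have hm0 : m₀ ≤ m := ((le_max_left _ _).trans (le_max_left _ _)).trans hm
  have hm1 : m₁ ≤ m := ((le_max_right _ _).trans (le_max_left _ _)).trans hm
  have hm5 : m₅ ≤ m := ((le_max_left _ _).trans (le_max_right _ _)).trans hm
  have hmpos : 1 ≤ m := ((le_max_right _ _).trans (le_max_right _ _)).trans hm
  have hnpos : 0 < n := lt_of_lt_of_le (by omega) (le_trans (Nat.le_mul_of_pos_left m (by omega)) hAn)
  set q : ℝ := (m : ℝ) / n with hq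
  have hq0 : 0 < q := by
    have : (0 : ℝ) < m := by exact_mod_cast hmpos
    have : (0 : ℝ) < n := by exact_mod_cast hnpos
    positivity
  have hqa : 0 ≤ q ^ a := Real.rpow_nonneg hq0.le _
  obtain ⟨m', n', m'', n'', hmm', hm'A, hnA, hmm'', hm''A, hnA', hle⟩ := hR s c m n hm1 hAn
  -- the two sub-annuli are nonempty
  have hsub : ∀ {m₂ n₂ : ℕ}, m₂ ≤ A * m → n ≤ A * n₂ → m₂ ≤ n₂ ∧ 0 < n₂ := by
    intro m₂ n₂ hm₂ hn₂
    have h1 : A * m₂ ≤ A * n₂ := by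
      calc A * m₂ ≤ A * (A * m) := Nat.mul_le_mul_left A hm₂
        _ = A * A * m := by ring
        _ ≤ n := hAn
        _ ≤ A * n₂ := hn₂
    exact ⟨Nat.le_of_mul_le_mul_left h1 (by omega),
      Nat.pos_of_mul_pos_left (lt_of_lt_of_le hnpos hn₂)⟩
  obtain ⟨hm'n', hn'pos⟩ := hsub hm'A hnA
  obtain ⟨hm''n'', hn''pos⟩ := hsub hm''A hnA'
  -- the three factors
  set P5 : ℝ := (M k (γ s).1 (γ s).2).real
    (BondConfig.relabel (sym2Equiv (Site.shift (-c))) ⁻¹' zdFiveArmClusters m' n') with hP5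
  have hP50 : 0 ≤ P5 := measureReal_nonneg
  set Pd : ℝ := (M k (γ s).1 (γ s).2).real {ω | ∃ (u w : Site 2) (q : (zdGraph 2).Walk u w),
    u - c ∈ box 2 (m'' - 1) ∧ w - c ∉ box 2 n'' ∧ ∀ e ∈ q.edges, e ∈ dualConfig ω} with hPd
  have hPd0 : 0 ≤ Pd := measureReal_nonneg
  have hratio2 : ((m' : ℝ) / n') ^ (2 : ℕ) ≤ B₂ * q ^ (2 : ℕ) := by
    rw [hB₂, ← mul_pow]
    exact pow_le_pow_left₀ (by positivity) (subAnnulus_ratio_le hnpos hn'pos hm'A hnA) 2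
  have hfive : P5 ≤ D₅ * (B₂ * q ^ (2 : ℕ)) :=
    (h₅ s c m' n' (hm5.trans hmm') hm'n').trans
      ((mul_le_mul_of_nonneg_right (le_max_left _ _) (sq_nonneg _)).trans
        (mul_le_mul_of_nonneg_left hratio2 hD₅0))
  have hd : Pd ≤ c' * (B * q ^ a) :=
    (hdual s c m'' n'' (hm0.trans hmm'') hm''n'').trans
      (mul_le_mul_of_nonneg_left (subAnnulus_ratio_rpow_le hnpos hn''pos hm''A hnA' ha.le) hc'.le)
  have hpow : q ^ (2 + a) = q ^ (2 : ℕ) * q ^ a := by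
    rw [Real.rpow_add hq0, Real.rpow_two]
  calc (M k (γ s).1 (γ s).2).real (sixArmThreeClustersAt c m n) ≤ C * P5 * Pd := hle
    _ ≤ D * P5 * Pd :=
        mul_le_mul_of_nonneg_right (mul_le_mul_of_nonneg_right (le_max_left _ _) hP50) hPd0
    _ ≤ D * (D₅ * (B₂ * q ^ (2 : ℕ))) * (c' * (B * q ^ a)) :=
        mul_le_mul (mul_le_mul_of_nonneg_left hfive hD0) hd hPd0
          (mul_nonneg hD0 (mul_nonneg hD₅0 (mul_nonneg (by positivity) (sq_nonneg _))))
    _ = D * (D₅ * B₂) * (c' * B) * (q ^ (2 : ℕ) * q ^ a) := by ring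
    _ = D * (D₅ * B₂) * (c' * B) * q ^ (2 + a) := by rw [hpow]

end Summit.CriticalPhenomena.CardyFormulaZ2.Theorems.CardySelfRefinement.FarField

end
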